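import Mathlib.Analysis.SpecialFunctions.Trigonometric.Deriv
import Summits.Ventures.CertifiedManyBodySolver.Downfold.EmeryBlochBand
import HarnessLib

/-!
# The DIRECT one-band (Wannier) in-plane band from its hopping shells: exact `(cos kx, cos ky)` polynomial
# form, gradient, and kernel-evaluable `ArithExpr` terms

Venture CertifiedManyBodySolver, cell `pub/hubbard-downfold` (stage S1, technique B = three-band-derived band vs
the DIRECT one-band Wannier fit; HUMAN RULINGS D-0096/D-0098: the reduction error is carried explicitly), seat
hubbard-downfold-mod-4; namespace `Summit.Ventures.CertifiedManyBodySolver.Downfold.Emery`. Everything here is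
PROVED. WHAT THIS IS NOT: a statement about any material (no number lives here); not a many-body statement (`U = 0`
one-body kinematics); the hopping amplitudes a consumer plugs in are SCREENING-GRADE Kohn–Sham / Wannier outputs.

A tetragonal single-layer one-band Wannier Hamiltonian `H = Σ_R H(R) c†_{r+R} c_r` has the in-plane (k_z-averaged)
dispersion `ε(k) = Σ_shells h · star_{(m,n)}(k)`, the star of the in-plane vector `(m a, n a)` (`m ≥ n ≥ 0`)
contributing `2(cos m kx + cos m ky)` (`n = 0 < m`), `4 cos m kx cos m ky` (`m = n > 0`),
`4(cos m kx cos n ky + cos n kx cos m ky)` (`m > n > 0`), `1` (on-site). [cite: AndersenEtAl1995, §6] writes the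
first three shells as the `t–t′–t″` form (`t = −H(a,0)`, `t′ = −H(a,a)`, `t″ = −H(2a,0)`; dictionary D0 of
`EmeryBlochBand.oneBand`, `ipBandK_ttt`).

* §1 `cheb m` (`m ≤ 4`, Chebyshev `T_m` explicitly), `cheb_cos : cheb m (cos k) = cos (m k)`, derivative `dcheb`.
* §2 shells `S : List (ℕ × ℕ × ℚ)` (entries `(m, n, h)`), `starK / starUV`, the band `ipBandK S kx ky` and its
  polynomial form `ipBandUV S u v` in `u = cos kx, v = cos ky` (`ipBandK_eq_UV` for shells with `m, n ≤ 4`),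
  symmetry `ipBandUV_comm`, exact rational evaluation `ipBandQ` (`cast_ipBandQ`).
* §3 the `u`-derivative `ipBandU S u v` (`hasDerivAt_ipBandUV`), the momentum derivatives
  `∂ε/∂kx = −sin kx · ipBandU S (cos kx) (cos ky)` (`hasDerivAt_ipBandK_kx/ky`) and the squared Fermi velocity
  `ipGradSq = (∂ε/∂kx)² + (∂ε/∂ky)²` with its polynomial form `ipGradSqUV` (`ipGradSq_eq_UV`).
* the kernel-evaluable `ArithExpr` terms of the band and its velocity (for the tree's kd-tree box verifier) are in
  the companion file `OneBandInPlaneExpr`.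

Sources: `t–t′–t″` form [AndersenEtAl1995, §6]; interval/box verification [Moore1966, Theorem 3.1, §4.4].
-/

noncomputable section

namespace Summit.Ventures.CertifiedManyBodySolver.Downfold.Emery

open Real

/-! ## §1 Chebyshev polynomials `T_m`, `m ≤ 4` -/

/-- `T_m(u)` for `m ≤ 4` explicitly (`0` for `m ≥ 5`, outside the shells used here). [folklore] -/
def cheb : ℕ → ℝ → ℝ
  | 0, _ => 1
  | 1, u => u
  | 2, u => 2 * u ^ 2 - 1
  | 3, u => 4 * u ^ 3 - 3 * u
  | 4, u => 8 * u ^ 4 - 8 * u ^ 2 + 1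
  | _, _ => 0

/-- Rational twin of `cheb`. [folklore] -/
def chebQ : ℕ → ℚ → ℚ
  | 0, _ => 1
  | 1, u => u
  | 2, u => 2 * u ^ 2 - 1
  | 3, u => 4 * u ^ 3 - 3 * u
  | 4, u => 8 * u ^ 4 - 8 * u ^ 2 + 1
  | _, _ => 0

/-- `T_m′(u)` for `m ≤ 4`. [folklore] -/
def dcheb : ℕ → ℝ → ℝ
  | 1, _ => 1
  | 2, u => 4 * u
  | 3, u => 12 * u ^ 2 - 3
  | 4, u => 32 * u ^ 3 - 16 * u
  | _, _ => 0

/-- [folklore] -/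
theorem cast_chebQ (m : ℕ) (u : ℚ) : ((chebQ m u : ℚ) : ℝ) = cheb m u := by
  match m with
  | 0 => simp [cheb, chebQ]
  | 1 => simp [cheb, chebQ]
  | 2 => simp [cheb, chebQ]
  | 3 => simp [cheb, chebQ]
  | 4 => simp [cheb, chebQ]
  | k + 5 => simp [cheb, chebQ]

/-- `cos (4k) = 8cos⁴k − 8cos²k + 1`. [folklore] -/
theorem cos_four_mul' (k : ℝ) : cos (4 * k) = 8 * cos k ^ 4 - 8 * cos k ^ 2 + 1 := by
  have h : (4 : ℝ) * k = 2 * (2 * k) := by ring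
  rw [h, cos_two_mul, cos_two_mul]; ring

/-- **`T_m(cos k) = cos(m k)` for `m ≤ 4`.** [folklore] -/
theorem cheb_cos {m : ℕ} (hm : m ≤ 4) (k : ℝ) : cheb m (cos k) = cos (m * k) := by
  interval_cases m
  · simp [cheb]
  · simp [cheb]
  · simp only [cheb, Nat.cast_ofNat, cos_two_mul]
  · simp only [cheb, Nat.cast_ofNat, cos_three_mul]
  · simp only [cheb, Nat.cast_ofNat, cos_four_mul']

/-- `T_m` has derivative `dcheb m`. [folklore] -/
theorem hasDerivAt_cheb (m : ℕ) (u : ℝ) : HasDerivAt (fun w => cheb m w) (dcheb m u) u := by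
  match m with
  | 0 => simp only [cheb, dcheb]; exact hasDerivAt_const u (1 : ℝ)
  | 1 => simp only [cheb, dcheb]; exact hasDerivAt_id' u
  | 2 =>
    simp only [cheb, dcheb]
    have h := ((hasDerivAt_pow 2 u).const_mul (2 : ℝ)).sub_const (1 : ℝ)
    exact h.congr_deriv (by norm_num; ring)
  | 3 =>
    simp only [cheb, dcheb]
    have h := ((hasDerivAt_pow 3 u).const_mul (4 : ℝ)).sub ((hasDerivAt_id' u).const_mul (3 : ℝ))
    exact h.congr_deriv (by norm_num; ring)
  | 4 =>
    simp only [cheb, dcheb]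
    have h := (((hasDerivAt_pow 4 u).const_mul (8 : ℝ)).sub ((hasDerivAt_pow 2 u).const_mul (8 : ℝ))).add_const (1 : ℝ)
    exact h.congr_deriv (by norm_num; ring)
  | k + 5 => simp only [cheb, dcheb]; exact hasDerivAt_const u (0 : ℝ)

/-- `T_m` is continuous. [folklore] -/
theorem continuous_cheb (m : ℕ) : Continuous (fun w => cheb m w) :=
  continuous_iff_continuousAt.2 fun u => (hasDerivAt_cheb m u).continuousAt

/-! ## §2 Shells, stars and the band -/

/-- The star sum of the in-plane shell `(m a, n a)` at momentum `(kx, ky)` (lattice constant `a = 1`):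
`1` (on-site), `2(cos m kx + cos m ky)` (`n = 0 < m`), `4 cos m kx cos m ky` (`m = n > 0`),
`4(cos m kx cos n ky + cos n kx cos m ky)` otherwise. [cite: AndersenEtAl1995, §6] -/
def starK (m n : ℕ) (kx ky : ℝ) : ℝ :=
  if n = 0 then (if m = 0 then 1 else 2 * (cos (m * kx) + cos (m * ky)))
  else if m = n then 4 * (cos (m * kx) * cos (m * ky))
  else 4 * (cos (m * kx) * cos (n * ky) + cos (n * kx) * cos (m * ky))

/-- The same star as a polynomial in `u = cos kx`, `v = cos ky`. [folklore] -/
def starUV (m n : ℕ) (u v : ℝ) : ℝ :=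
  if n = 0 then (if m = 0 then 1 else 2 * (cheb m u + cheb m v))
  else if m = n then 4 * (cheb m u * cheb m v)
  else 4 * (cheb m u * cheb n v + cheb n u * cheb m v)

/-- Rational twin of `starUV`. [folklore] -/
def starQ (m n : ℕ) (u v : ℚ) : ℚ :=
  if n = 0 then (if m = 0 then 1 else 2 * (chebQ m u + chebQ m v))
  else if m = n then 4 * (chebQ m u * chebQ m v)
  else 4 * (chebQ m u * chebQ n v + chebQ n u * chebQ m v)

/-- [folklore] -/
theorem cast_starQ (m n : ℕ) (u v : ℚ) : ((starQ m n u v : ℚ) : ℝ) = starUV m n u v := by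
  unfold starQ starUV
  split_ifs <;> push_cast [cast_chebQ] <;> ring

/-- `starK = starUV ∘ cos` for shells with `m, n ≤ 4`. [folklore] -/
theorem starK_eq_UV {m n : ℕ} (hm : m ≤ 4) (hn : n ≤ 4) (kx ky : ℝ) :
    starK m n kx ky = starUV m n (cos kx) (cos ky) := by
  unfold starK starUV
  simp only [cheb_cos hm, cheb_cos hn]

/-- The star polynomial is symmetric under `u ↔ v`. [folklore] -/
theorem starUV_comm (m n : ℕ) (u v : ℝ) : starUV m n u v = starUV m n v u := by
  unfold starUV; split_ifs <;> ring

/-- **The in-plane one-band dispersion** of a shell list `S = [(m, n, h), …]`: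
`ε(k) = Σ h · star_{(m,n)}(k)` (energy units of `h`; `a = 1`). [cite: AndersenEtAl1995, §6] -/
def ipBandK (S : List (ℕ × ℕ × ℚ)) (kx ky : ℝ) : ℝ :=
  (S.map fun s => (s.2.2 : ℝ) * starK s.1 s.2.1 kx ky).sum

/-- Its polynomial form in `u = cos kx`, `v = cos ky`. [folklore] -/
def ipBandUV (S : List (ℕ × ℕ × ℚ)) (u v : ℝ) : ℝ :=
  (S.map fun s => (s.2.2 : ℝ) * starUV s.1 s.2.1 u v).sum

/-- Exact rational evaluation of the polynomial form. [folklore] -/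
def ipBandQ (S : List (ℕ × ℕ × ℚ)) (u v : ℚ) : ℚ :=
  (S.map fun s => s.2.2 * starQ s.1 s.2.1 u v).sum

/-- Boolean check: every shell has `m, n ≤ 4`. [folklore] -/
def shellsOK (S : List (ℕ × ℕ × ℚ)) : Bool :=
  S.all fun s => decide (s.1 ≤ 4) && decide (s.2.1 ≤ 4)

/-- [folklore] -/
theorem cast_ipBandQ (S : List (ℕ × ℕ × ℚ)) (u v : ℚ) : ((ipBandQ S u v : ℚ) : ℝ) = ipBandUV S u v := by
  induction S with
  | nil => simp [ipBandQ, ipBandUV]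
  | cons s S ih =>
    simp only [ipBandQ, ipBandUV, List.map_cons, List.sum_cons, Rat.cast_add, Rat.cast_mul, cast_starQ] at ih ⊢
    rw [ih]

/-- **`ε(k) = ipBandUV(cos kx, cos ky)`** for admissible shells. [folklore] -/
theorem ipBandK_eq_UV {S : List (ℕ × ℕ × ℚ)} (hS : shellsOK S = true) (kx ky : ℝ) :
    ipBandK S kx ky = ipBandUV S (cos kx) (cos ky) := by
  induction S with
  | nil => simp [ipBandK, ipBandUV]
  | cons s S ih =>
    simp only [shellsOK, List.all_cons, Bool.and_eq_true, decide_eq_true_eq] at hS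
    have ih' := ih (by simpa [shellsOK] using hS.2)
    simp only [ipBandK, ipBandUV, List.map_cons, List.sum_cons] at ih' ⊢
    rw [ih', starK_eq_UV hS.1.1 hS.1.2]

/-- The polynomial form is symmetric: `ε(u, v) = ε(v, u)` (tetragonal symmetry). [folklore] -/
theorem ipBandUV_comm (S : List (ℕ × ℕ × ℚ)) (u v : ℝ) : ipBandUV S u v = ipBandUV S v u := by
  induction S with
  | nil => simp [ipBandUV]
  | cons s S ih =>
    simp only [ipBandUV, List.map_cons, List.sum_cons] at ih ⊢
    rw [ih, starUV_comm]

/-- Dictionary D0: the three-shell list `[(0,0,c), (1,0,−t), (1,1,−t′), (2,0,−t″)]` IS `EmeryBlochBand.oneBand c t t′ t″`.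
[cite: AndersenEtAl1995, §6] -/
theorem ipBandK_ttt (c t t' t'' : ℚ) (kx ky : ℝ) :
    ipBandK [(0, 0, c), (1, 0, -t), (1, 1, -t'), (2, 0, -t'')] kx ky = oneBand c t t' t'' kx ky := by
  simp [ipBandK, starK, oneBand]
  ring

/-! ## §3 Derivatives and the squared Fermi velocity -/

/-- `∂/∂u` of the star polynomial. [folklore] -/
def dstarU (m n : ℕ) (u v : ℝ) : ℝ :=
  if n = 0 then (if m = 0 then 0 else 2 * dcheb m u)
  else if m = n then 4 * (dcheb m u * cheb m v)
  else 4 * (dcheb m u * cheb n v + dcheb n u * cheb m v)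

/-- [folklore] -/
theorem hasDerivAt_starUV (m n : ℕ) (u v : ℝ) :
    HasDerivAt (fun u => starUV m n u v) (dstarU m n u v) u := by
  unfold starUV dstarU
  by_cases hn : n = 0
  · by_cases hm : m = 0
    · simp only [hn, hm, if_true]; exact hasDerivAt_const u 1
    · simp only [hn, hm, if_true, if_false]
      exact ((hasDerivAt_cheb m u).add_const (cheb m v)).const_mul 2
  · by_cases hmn : m = n
    · simp only [hn, hmn, if_true, if_false]
      exact ((hasDerivAt_cheb n u).mul_const (cheb n v)).const_mul 4
    · simp only [hn, hmn, if_false]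
      exact (((hasDerivAt_cheb m u).mul_const (cheb n v)).add
        ((hasDerivAt_cheb n u).mul_const (cheb m v))).const_mul 4

/-- **`∂ε/∂u`** of the polynomial form. [folklore] -/
def ipBandU (S : List (ℕ × ℕ × ℚ)) (u v : ℝ) : ℝ :=
  (S.map fun s => (s.2.2 : ℝ) * dstarU s.1 s.2.1 u v).sum

/-- [folklore] -/
theorem hasDerivAt_ipBandUV (S : List (ℕ × ℕ × ℚ)) (u v : ℝ) :
    HasDerivAt (fun u => ipBandUV S u v) (ipBandU S u v) u := by
  induction S with
  | nil => simp only [ipBandUV, ipBandU, List.map_nil, List.sum_nil]; exact hasDerivAt_const u (0 : ℝ)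
  | cons s S ih =>
    have h := ((hasDerivAt_starUV s.1 s.2.1 u v).const_mul (s.2.2 : ℝ)).add ih
    simp only [ipBandUV, ipBandU, List.map_cons, List.sum_cons]
    exact h

/-- `∂ε/∂v (u, v) = ipBandU S v u` (symmetry). [folklore] -/
theorem hasDerivAt_ipBandUV_v (S : List (ℕ × ℕ × ℚ)) (u v : ℝ) :
    HasDerivAt (fun v => ipBandUV S u v) (ipBandU S v u) v := by
  have h := hasDerivAt_ipBandUV S v u
  have hf : (fun v => ipBandUV S u v) = fun v => ipBandUV S v u := by
    funext w; exact ipBandUV_comm S u w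
  rw [hf]; exact h

/-- **`∂ε/∂kx = −sin kx · ∂_u ε(cos kx, cos ky)`.** [folklore] -/
theorem hasDerivAt_ipBandK_kx {S : List (ℕ × ℕ × ℚ)} (hS : shellsOK S = true) (kx ky : ℝ) :
    HasDerivAt (fun kx => ipBandK S kx ky) (-sin kx * ipBandU S (cos kx) (cos ky)) kx := by
  have hf : (fun kx => ipBandK S kx ky) = fun kx => ipBandUV S (cos kx) (cos ky) := by
    funext k; exact ipBandK_eq_UV hS k ky
  rw [hf]
  have h := (hasDerivAt_ipBandUV S (cos kx) (cos ky)).comp kx (hasDerivAt_cos kx)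
  exact h.congr_deriv (by ring)

/-- **`∂ε/∂ky = −sin ky · ∂_u ε(cos ky, cos kx)`.** [folklore] -/
theorem hasDerivAt_ipBandK_ky {S : List (ℕ × ℕ × ℚ)} (hS : shellsOK S = true) (kx ky : ℝ) :
    HasDerivAt (fun ky => ipBandK S kx ky) (-sin ky * ipBandU S (cos ky) (cos kx)) ky := by
  have hf : (fun ky => ipBandK S kx ky) = fun ky => ipBandUV S (cos kx) (cos ky) := by
    funext k; exact ipBandK_eq_UV hS kx k
  rw [hf]
  have h := (hasDerivAt_ipBandUV_v S (cos kx) (cos ky)).comp ky (hasDerivAt_cos ky)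
  exact h.congr_deriv (by ring)

/-- **The squared Fermi velocity** `|∇_k ε|² = (∂ε/∂kx)² + (∂ε/∂ky)²` (units: energy × lattice constant, ħ = 1),
written with the derivatives of `hasDerivAt_ipBandK_kx/ky`. [folklore] -/
def ipGradSq (S : List (ℕ × ℕ × ℚ)) (kx ky : ℝ) : ℝ :=
  (-sin kx * ipBandU S (cos kx) (cos ky)) ^ 2 + (-sin ky * ipBandU S (cos ky) (cos kx)) ^ 2

/-- Its polynomial form: `(1 − u²)·(∂_u ε)² + (1 − v²)·(∂_v ε)²`. [folklore] -/
def ipGradSqUV (S : List (ℕ × ℕ × ℚ)) (u v : ℝ) : ℝ :=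
  (1 - u ^ 2) * ipBandU S u v ^ 2 + (1 - v ^ 2) * ipBandU S v u ^ 2

/-- `|∇ε|² = ipGradSqUV(cos kx, cos ky)`. [folklore] -/
theorem ipGradSq_eq_UV (S : List (ℕ × ℕ × ℚ)) (kx ky : ℝ) :
    ipGradSq S kx ky = ipGradSqUV S (cos kx) (cos ky) := by
  unfold ipGradSq ipGradSqUV
  have hx : sin kx ^ 2 = 1 - cos kx ^ 2 := by rw [sin_sq]
  have hy : sin ky ^ 2 = 1 - cos ky ^ 2 := by rw [sin_sq]
  rw [mul_pow, mul_pow, neg_sq, neg_sq, hx, hy]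

/-- On the zone diagonal `kx = ky`: `|∇ε|² = 2(1 − u²)(∂_u ε(u,u))²`. [folklore] -/
theorem ipGradSqUV_diag (S : List (ℕ × ℕ × ℚ)) (u : ℝ) :
    ipGradSqUV S u u = 2 * (1 - u ^ 2) * ipBandU S u u ^ 2 := by
  unfold ipGradSqUV; ring

/-- On the zone face `kx = π` (`u = −1`): `|∇ε|² = (1 − v²)(∂_u ε(v,−1))²`. [folklore] -/
theorem ipGradSqUV_face (S : List (ℕ × ℕ × ℚ)) (v : ℝ) :
    ipGradSqUV S (-1) v = (1 - v ^ 2) * ipBandU S v (-1) ^ 2 := by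
  unfold ipGradSqUV; ring

end Summit.Ventures.CertifiedManyBodySolver.Downfold.Emery
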